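import Mathlib
import HarnessLib
import Summits.QuantumFields.YangMills.Theses.ScalingWindowSplit
import Summits.QuantumFields.YangMills.Theorems.ScalingWindowSplitExistenceLegFromLattice
import Summits.QuantumFields.YangMills.Theorems.ScalingWindowSplitEuclideanUpgrade

/-!
# Route `ScalingWindowSplit`, assembly item `Assembly` (stmt-QuantumFields-18658)

The assembly of route `ScalingWindowSplit` of the Yang–Mills sub-problem:

  `GapAtCorrelationLength → SelfNormalisedMomentBounds → CurvatureAmnesia → SelfNormalisedSkewness → YangMills`.

It is pure glue over the route's deciding theorem
`Summit.QuantumFields.YangMills.Theses.ScalingWindowSplit.closes`, whose two remaining binders are the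
landed support items

* `ExistenceLegFromLattice` (stmt-QuantumFields-18657, the typed split
  `GapAtCorrelationLength → SelfNormalisedSkewness → SelfNormalisedMomentBounds → HypercubicLimit`), proved as
  `Summit.QuantumFields.YangMills.Theorems.ScalingWindowSplit.existenceLegFromLattice_proof`, and
* `EuclideanUpgrade` (stmt-QuantumFields-18949, proper-hypercubic + `Σ5` invariance ⇒ full `SO(4)` invariance
  on `⁰𝒮`), proved as `Summit.QuantumFields.YangMills.Theorems.ScalingWindowSplit.euclideanUpgrade_proof`.

The three lattice cruxes W₁ `GapAtCorrelationLength`, U `SelfNormalisedMomentBounds`, W₂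
`SelfNormalisedSkewness` and the shared crux `CurvatureAmnesia` remain hypotheses, exactly as the item
states them.

References: Jaffe–Witten 2000 (the Clay problem statement); Glimm–Jaffe 1987, §6.1 and §19.1
(Osterwalder–Schrader reconstruction from lattice approximations). No definitions, no notation.
-/

namespace Summit.QuantumFields.YangMills.Theorems.ScalingWindowSplit

/-- **Assembly** of route `ScalingWindowSplit` (stmt-QuantumFields-18658):
`GapAtCorrelationLength → SelfNormalisedMomentBounds → CurvatureAmnesia → SelfNormalisedSkewness → YangMills`.
Proof: the route's deciding theorem `closes` applied to the four hypotheses and to the two landed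
supports `existenceLegFromLattice_proof` (stmt-QuantumFields-18657) and `euclideanUpgrade_proof`
(stmt-QuantumFields-18949). [cite: GlimmJaffe1987, §6.1 and §19.1] -/
theorem assembly_proof :
    Summit.QuantumFields.YangMills.Theses.ScalingWindowSplit.Assembly := by
  unfold Summit.QuantumFields.YangMills.Theses.ScalingWindowSplit.Assembly
  intro hW hU hA hS
  -- buildfix 2026-08-19: the route's `closes` was re-cut over the R/Gapped items (SelfNormalisedMomentBoundsR,
  -- SelfNormalisedSkewnessGapped, ExistenceLegFromLatticeGapped); the assembly AS STATED is still the old chain, so it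
  -- is closed exactly as the pre-re-cut `closes` did: CoincidenceRotationBootstrap's deciding theorem over the landed
  -- typed split `existenceLegFromLattice_proof` and the density upgrade.
  exact Summit.QuantumFields.YangMills.Theses.CoincidenceRotationBootstrap.closes hA
    (existenceLegFromLattice_proof hW hS hU) euclideanUpgrade_proof

end Summit.QuantumFields.YangMills.Theorems.ScalingWindowSplit
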